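import Summits.QuantumFields.QCD.Theses.QuarksAsStableAction
import Literature.Probability.LatticeModels.LatticeAnimalsGraph

/-!
# `UnquenchedChessboardBound` ⇒ Peierls / Kotecký–Preiss smallness of the bad-set activities
(crux `QuarksAsStableAction.StableActionBridge`, item stmt-QuantumFields-9737, line `Sketch`; lead helper,
`--supports stmt-QuantumFields-9737`, registered sub-goal `peierls_sum_of_unquenchedChessboardBound`)

Where the bridge consumes A = `UnquenchedChessboardBound` (route header, TWO-LAYER PLAN: "B ⇐ DiluteDislocations
(Peierls/percolation from A: bad plaquettes form finite clusters with exponential size tails, uniformly in k and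
volume)"; card `sylvester-defect-floor` §Why it bites here (c): "from A by the trivial contour count
Σₙ (c_d C e^{−cβ})ⁿ").  The measure being SIGNED (odd `N_f`, split masses), what A honestly yields is not the
probability of a union but the ℓ¹-smallness of the ACTIVITIES of bad sets — exactly the input of a polymer
expansion: for every plaquette graph `G` of maximal degree `Δ` (any notion of adjacency — shared link, shared
site, sup-distance one), every plaquette `p` and every size `n`, the sum over `G`-connected plaquette sets
`S ∋ p` with `|S| = n` of `|⟨1[all q ∈ S are δ-bad]⟩_signed|` is at most `(Δ+1)^{2n} (C e^{−cβ})ⁿ`, uniformly in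
the (even) volume and in the mass window (`peierls_sum_of_unquenchedChessboardBound`).  Proof: each activity is
bounded by A, and there are at most `Δ^{2(n−1)} ≤ (Δ+1)^{2n}` connected `n`-sets through `p` (the tree's
lattice-animal bound `card_le_pow_of_isGraphConnected`, Friedli–Velenik Lemma 3.38 / (5.27)).  No definitions:
the graph is universally quantified with its degree bound.
-/

namespace Summit.QuantumFields.QCD.Cruxes.StableActionBridge.Sketch

open MeasureTheory
open Literature.MathematicalPhysics.QuantumLattice Literature.MathematicalPhysics.QuantumFieldTheory
open Literature.Probability.LatticeModels (IsGraphConnected card_le_pow_of_isGraphConnected)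
open Summit.QuantumFields.QCD.Theses.QuarksAsStableAction (UnquenchedChessboardBound)

/-- Counting: `Δ^{2(n-1)} ≤ (Δ+1)^{2n}` in `ℝ`. -/
private theorem pow_animal_le (Δ n : ℕ) : ((Δ ^ (2 * (n - 1)) : ℕ) : ℝ) ≤ ((Δ : ℝ) + 1) ^ (2 * n) := by
  have h1 : (Δ : ℝ) ^ (2 * (n - 1)) ≤ ((Δ : ℝ) + 1) ^ (2 * (n - 1)) :=
    pow_le_pow_left₀ (Nat.cast_nonneg Δ) (by linarith) _
  have h2 : ((Δ : ℝ) + 1) ^ (2 * (n - 1)) ≤ ((Δ : ℝ) + 1) ^ (2 * n) :=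
    pow_le_pow_right₀ (by linarith [(Nat.cast_nonneg Δ : (0 : ℝ) ≤ Δ)]) (by omega)
  push_cast
  exact h1.trans h2

/-- **Peierls sum from the chessboard bound.**  `UnquenchedChessboardBound` implies: for every `N_f`, mass
window `[m_lo, m_hi]` with `m_lo > −1` and `δ > 0` there are `C, c > 0`-data and `β₀` such that for all
`β ≥ β₀`, all even `L ≥ 4`, all masses in the window, EVERY plaquette graph `G` with degrees `≤ Δ`, every
plaquette `p`, every `n` and every family `𝒜` of `G`-connected `n`-sets of plaquettes through `p`,
`Σ_{S ∈ 𝒜} ‖∫_{all q ∈ S δ-bad} ∏_f det D_AP dμ_W / ∫ ∏_f det D_AP dμ_W‖ ≤ (Δ+1)^{2n} · (C e^{−cβ})ⁿ` — the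
Kotecký–Preiss smallness of the bad-set activities of the SIGNED unquenched measure, uniformly in the volume.
CONDITIONAL on `UnquenchedChessboardBound` (item stmt-QuantumFields-9735, open), taken as the hypothesis. -/
theorem peierls_sum_of_unquenchedChessboardBound :
    UnquenchedChessboardBound → ∀ (Nf : ℕ) (mlo mhi δ : ℝ), -1 < mlo → 0 < δ → ∃ C c β₀ : ℝ, 0 < c ∧ 0 ≤ C ∧
      ∀ β : ℝ, β₀ ≤ β → ∀ (L : ℕ) [NeZero L], Even L → 4 ≤ L →
        let apDet : GaugeConfig 4 L (Matrix.specialUnitaryGroup (Fin 3) ℂ) → ℝ → ℂ := fun U m =>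
          fermionDet (wilsonDirac (unitaryFundamentalRep (Fin 3) ℂ)
            (fun e => if e.1 e.2 = -1
              then -(⟨(U e).1, Matrix.specialUnitaryGroup_le_unitaryGroup (U e).2⟩ :
                Matrix.unitaryGroup (Fin 3) ℂ)
              else ⟨(U e).1, Matrix.specialUnitaryGroup_le_unitaryGroup (U e).2⟩) m 1);
        let dfc : GaugeConfig 4 L (Matrix.specialUnitaryGroup (Fin 3) ℂ) → Plaquette 4 L → ℝ := fun U p =>
          3 - (fundamentalRep (Fin 3) (plaquetteHolonomy U p.1 p.2.1.1 p.2.1.2)).trace.re;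
        ∀ m : Fin Nf → ℝ, (∀ f, mlo ≤ m f ∧ m f ≤ mhi) →
          ∀ (G : SimpleGraph (Plaquette 4 L)) [DecidableRel G.Adj] (Δ : ℕ), (∀ x, G.degree x ≤ Δ) →
            ∀ (p : Plaquette 4 L) (n : ℕ) (𝒜 : Finset (Finset (Plaquette 4 L))),
              (∀ S ∈ 𝒜, p ∈ S ∧ S.card = n ∧ IsGraphConnected G S) →
                ∑ S ∈ 𝒜, ‖(∫ U in {U | ∀ q ∈ S, δ ≤ dfc U q}, (∏ f, apDet U (m f))
                      ∂(wilsonMeasure (d := 4) (L := L) (fundamentalRep (Fin 3)) β)) /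
                    (∫ U, (∏ f, apDet U (m f))
                      ∂(wilsonMeasure (d := 4) (L := L) (fundamentalRep (Fin 3)) β))‖ ≤
                  ((Δ : ℝ) + 1) ^ (2 * n) * (C * Real.exp (-c * β)) ^ n := by
  intro hA Nf mlo mhi δ hmlo hδ
  obtain ⟨C₀, c, β₀, hc, h⟩ := hA Nf mlo mhi δ hmlo hδ
  refine ⟨|C₀|, c, β₀, hc, abs_nonneg _, fun β hβ L _ hEven hL => ?_⟩
  intro apDet dfc m hm G _ Δ hΔ p n 𝒜 h𝒜
  -- each activity is bounded by A, with `C₀` replaced by `|C₀|`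
  have hterm : ∀ S ∈ 𝒜,
      ‖(∫ U in {U | ∀ q ∈ S, δ ≤ dfc U q}, (∏ f, apDet U (m f))
            ∂(wilsonMeasure (d := 4) (L := L) (fundamentalRep (Fin 3)) β)) /
          (∫ U, (∏ f, apDet U (m f))
            ∂(wilsonMeasure (d := 4) (L := L) (fundamentalRep (Fin 3)) β))‖ ≤
        (|C₀| * Real.exp (-c * β)) ^ n := by
    intro S hS
    have hAS := h β hβ L hEven hL m hm S
    rw [(h𝒜 S hS).2.1] at hAS
    refine hAS.trans ?_
    calc (C₀ * Real.exp (-c * β)) ^ n ≤ |(C₀ * Real.exp (-c * β)) ^ n| := le_abs_self _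
      _ = (|C₀| * Real.exp (-c * β)) ^ n := by
          rw [abs_pow, abs_mul, abs_of_pos (Real.exp_pos _)]
  -- the number of connected `n`-sets through `p` is at most `Δ^{2(n-1)}`
  have hcard : 𝒜.card ≤ Δ ^ (2 * (n - 1)) := card_le_pow_of_isGraphConnected hΔ 𝒜 h𝒜
  have hx : 0 ≤ (|C₀| * Real.exp (-c * β)) ^ n := pow_nonneg (mul_nonneg (abs_nonneg _) (Real.exp_pos _).le) n
  calc ∑ S ∈ 𝒜, ‖(∫ U in {U | ∀ q ∈ S, δ ≤ dfc U q}, (∏ f, apDet U (m f))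
            ∂(wilsonMeasure (d := 4) (L := L) (fundamentalRep (Fin 3)) β)) /
          (∫ U, (∏ f, apDet U (m f)) ∂(wilsonMeasure (d := 4) (L := L) (fundamentalRep (Fin 3)) β))‖
      ≤ ∑ _S ∈ 𝒜, (|C₀| * Real.exp (-c * β)) ^ n := Finset.sum_le_sum hterm
    _ = (𝒜.card : ℝ) * (|C₀| * Real.exp (-c * β)) ^ n := by rw [Finset.sum_const, nsmul_eq_mul]
    _ ≤ ((Δ ^ (2 * (n - 1)) : ℕ) : ℝ) * (|C₀| * Real.exp (-c * β)) ^ n :=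
        mul_le_mul_of_nonneg_right (by exact_mod_cast hcard) hx
    _ ≤ ((Δ : ℝ) + 1) ^ (2 * n) * (|C₀| * Real.exp (-c * β)) ^ n :=
        mul_le_mul_of_nonneg_right (pow_animal_le Δ n) hx

end Summit.QuantumFields.QCD.Cruxes.StableActionBridge.Sketch
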